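import Literature.Barriers.PneNP.MatchingSlackOddCutRank
import Literature.Barriers.PneNP.MatchingSlackPsdRankEightLower
import Literature.Barriers.PneNP.MatchingSlackPsdRankTenLower
import Literature.Barriers.PneNP.MatchingSlackPsdRankTwelveLower
import Literature.Combinatorics.Optimization.PsdRankCompressionParity
import Literature.Combinatorics.Optimization.SymmetricSDPMatching
import Literature.Combinatorics.AssociationSchemes.CutMatchingRestriction
import HarnessLib

/-!
# `rk_psd(S_odd(K_n)) ≥ C(n/2 + 1, 2)` for every even `n ≥ 8`: one more than the sharp fooling-set bound, for all `n`

Companion to `MatchingSlackPsdFoolingSetSharp.lean` (the explicit triangular pattern of size `C(m+1,2) − 1` in the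
odd-cut slack matrix `S_{UM} = |δ(U) ∩ M| − 1` of the perfect matching polytope of `K_{2m}`, `pmOddCutSlack (2m)`;
by the cell's exhaustive search the MAXIMUM triangular pattern for `m ≤ 6`), to the kernel-checked instances
`MatchingSlackPsdRank{Eight,Ten,Twelve}Lower.lean` (`rk_psd ≥ 10, 15, 21`, one more than the fooling bound, by
GRT compression + parity with machine-found patterns and minors) and to `PsdRankCompressionParity.lean` (the
criterion behind those instances). This file proves the `+1` FOR EVERY `n` AT ONCE, with no search and no `decide`:

* `not_hasPsdFactorization_pmOddCutSlack_choose` : `m ≥ 7 → ¬ HasPsdFactorization (pmOddCutSlack (2m)) (C(m+1,2) − 1)`;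
* `choose_le_of_hasPsdFactorization` : `m ≥ 7 → HasPsdFactorization (pmOddCutSlack (2m)) r → C(m+1,2) ≤ r`;
* `choose_half_succ_le_of_hasPsdFactorization` : for EVERY even `n ≥ 8`,
  `HasPsdFactorization (pmOddCutSlack n) r → C(n/2 + 1, 2) ≤ r` (`m ≥ 7` from this file, `n = 8, 10, 12` from the
  instances), i.e. `rk_psd(S_odd(K_n)) ≥ 10, 15, 21, 28, 36, 45, …`.

## The argument (three observations that make the small-`n` certificates parametric)

1. MINOR-LOCAL COMPRESSION (`not_hasPsdFactorization_of_minor_compression_parity`, §0). In the compression–parity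
   criterion [GouveiaRobinsonThomas2013, Prop. 2.6 (p06) + Lemma 2.4; FawziEtAl2015, Prop. 6.2 (p18);
   GouveiaRobinsonThomas2013, Ex. 2.3 (p05)] the triangular patterns inside zero sets are only needed for the ROWS
   AND COLUMNS OF THE PARITY MINOR, and the pattern rows/columns may be ANY rows/columns of the matrix (GRT Prop. 2.6
   compresses one factor at a time): rank-one factors on the minor already give a Hadamard square root OF THE MINOR
   of rank `≤` the size of the factorisation, which the parity count forbids. (The tree's
   `not_hasPsdFactorization_of_compression_parity` asks for patterns on every row and column of a block.)
2. THE PATTERNS ARE FREE (§3). In the sharp family `(U_x, T_x)_{x ∈ idx m}` of `MatchingSlackPsdFoolingSetSharp`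
   (`S(U_x, T_y) = 0` whenever `y` is earlier than `x`), all indices but the LAST form a triangular pattern of size
   `C(m+1,2) − 2` inside the zero set of the last row `U_last = {0} ∪ [4, n−1]` — the complement of the `3`-set
   `{1,2,3}`, and a set and its complement have the same row — and all indices but the FIRST form one inside the zero
   rows of the first column `T(n−1,n−2)`. Since `S_n` is transitive on `3`-sets and on perfect matchings
   (`exists_perm_fixing_image_eq`, `exists_conj_eq`) and crossing numbers are relabelling-invariant
   (`crossCount_image`), EVERY `3`-row and EVERY column has such a pattern (`exists_rowPattern_three`,
   `exists_colPattern`). Hence in a psd factorisation of size `C(m+1,2) − 1` all `3`-row factors and all column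
   factors have rank `≤ 1`.
3. AN EXPLICIT MINOR (§4). Rows: the triangles `{1, p, q}`; columns: the matchings `N(p,q) = M₀` with the blocks of
   `p` and `q` re-matched as `{p,q}, {p+1,q'}` (`M₀ = {01, 23, …}`, `p` even, `2 ≤ p`, `q ≥ p+2` in a later block):
   `N(p₁,q₁)` matches `1` to `0` and contains the edge `{p,q}` iff `(p₁,q₁) = (p,q)` (`SwapCol.swapFun_eq_iff`), so by
   `OddCutRank.pmOddCutSlack_toOdd` (`S({a,b,c}, M) = 2 − 2·#(edges of M inside)`) the minor is `2·(J − I)` of size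
   `k = (m−1)(m−2)` (`card_minorIdx`); `k` is even, so `(J + I)² = k·J + I = I` over `𝔽₂`
   (`offDiag_mul_offDiag_eq_one`): the minor's support is its own inverse. Finally `(m−1)(m−2) ≥ C(m+1,2)` iff
   `m ≥ 7` (`choose_le_card_minorIdx`); `m = 4, 5, 6` are the kernel instances (whose minors were found by search —
   at those `n` the identity minor is too small: `6, 12, 20 < 10, 15, 21`).

Everything is proved; there is no named fact; axioms `{propext, Classical.choice, Quot.sound}`; no `decide` on
data (the file elaborates in seconds at `maxHeartbeats 120000`). The private index bookkeeping of the sharp family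
(`idx`, `code`, `card_idx`, `code_injOn`, `shape_of_mem`) is read via `open private … from` (tree precedent:
`PlaquetteWalkDominoOSAWNoGo.lean`); only its two public crossing-number theorems `two_le_cc_rowOf_colOf`,
`cc_rowOf_colOf_eq_one` are used mathematically.

presearch (2026-08-29; corpus `lit search --hybrid` "positive semidefinite rank lower bound perfect matching
polytope slack matrix beyond fooling set Hadamard square root parity"; galaxy `psd rank of the matching|semidefinite
rank of the matching|square root rank`, all stars): nothing in print on psd-rank lower bounds for Edmonds' slack
matrix beyond triangular patterns; method-adjacent: Lee–Wei, "The square root rank of the correlation polytope is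
exponential" (arXiv:1411.6712) bounds the SQUARE ROOT rank (all factors rank one), which is what step 1 reduces to
on the minor. The cited steps are [GouveiaRobinsonThomas2013, Prop. 2.6, Lemma 2.4, Ex. 2.3 (p05–p07)] and
[FawziEtAl2015, Prop. 6.2 (p18)], page-confirmed in the companion files.

Honest limits. Exactly `+1` over the fooling bound `C(m+1,2) − 1 ≈ n²/8`: to exclude size `C(m+1,2)` the
compression step would leave rank-`≤ 2` factors, for which no square-root/parity handle is known (cell memo
MEMO-28 §5); the exact `S_n`-equivariant factorisation has size `Catalan(n/2)` and nothing between `C(n/2+1,2)` and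
`Catalan(n/2)` is decided; nothing asymptotic beyond the polynomial floor. Label: instrument / an all-`n` polynomial
floor for the route Target's object, strictly above the support-based optimum for `n ≤ 12`. WHAT THIS IS NOT: no
statement about the crux `TracialDecayExp20` (stmt-PneNP-19878, OPEN), no exponential or even super-quadratic
bound, no P-vs-NP content.
-/

noncomputable section

open Finset Matrix Equiv

namespace Literature.Barriers.PneNP

open Literature.Combinatorics.Optimization
  (HasPsdFactorization HasHadamardSqrtOfRankLE FawziEtAl2015_prop62_holds rank_rowFactor_add_le_of_triangular
    rank_colFactor_add_le_of_triangular isPMOn_univ_image_map)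
open Literature.Combinatorics.Optimization.CompressionParity (le_rank_of_hadamardSqrt_of_oddMinor)
open Literature.Combinatorics.AssociationSchemes.CutMatchingRestriction (crossCount crossCount_image cc_eq_crossCount)
open Literature.Combinatorics.AssociationSchemes.MatchingLevelInequality
  (fpfInvolutions mem_fpfInvolutions exists_perm_fixing_image_eq exists_conj_eq)
open Literature.Combinatorics.AssociationSchemes.HomogeneousMatchingFamilies
  (permOf edgesOf edgesOf_permOf permOf_mem_fpfInvolutions mk_mem_edgesOf_iff isPMOn_edgesOf)
open Literature.Combinatorics.SimpleGraph.CycleSpace (Crosses crosses_mk)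
open Literature.Combinatorics.Optimization.PMPolytopeDim (pmVec pmVec_apply)
open OddCutRank (Tri pmOddCutSlack_toOdd)

namespace PsdRankBeyondFooling

/-! ### §0 Generic tools: code-ordered patterns, parity on a `Fintype`-indexed minor, the minor-local criterion -/

/-- Enumerating a finite index set by DECREASING code: a `Fin |P|`-indexed list of the elements of `P` along
which the (injective) code strictly decreases. [folklore] -/
private theorem exists_fin_codeDecreasing {σ : Type*} (P : Finset σ) (code : σ → ℕ) (hinj : Set.InjOn code ↑P) :
    ∃ f : Fin P.card → σ, (∀ a, f a ∈ P) ∧ ∀ a b, a < b → code (f b) < code (f a) := by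
  classical
  by_cases hP : P = ∅
  · subst hP
    exact ⟨fun a => absurd a.2 (by simp), fun a => absurd a.2 (by simp), fun a => absurd a.2 (by simp)⟩
  obtain ⟨x0, hx0⟩ := Finset.nonempty_iff_ne_empty.2 hP
  haveI : Nonempty σ := ⟨x0⟩
  have hTcard : (P.image code).card = P.card := Finset.card_image_of_injOn hinj
  let e : Fin P.card ↪o ℕ := (P.image code).orderEmbOfFin hTcard
  let dec : ℕ → σ := Function.invFunOn code ↑P
  have hdec : ∀ i, dec (e i) ∈ P ∧ code (dec (e i)) = e i := by
    intro i
    have hi : e i ∈ P.image code := (P.image code).orderEmbOfFin_mem hTcard i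
    obtain ⟨x, hx, hxe⟩ := Finset.mem_image.1 hi
    have hex : ∃ x ∈ (↑P : Set σ), code x = e i := ⟨x, hx, hxe⟩
    exact ⟨Function.invFunOn_mem hex, Function.invFunOn_eq hex⟩
  refine ⟨fun a => dec (e (Fin.rev a)), fun a => (hdec _).1, fun a b hab => ?_⟩
  rw [(hdec _).2, (hdec _).2]
  exact e.strictMono (Fin.rev_lt_rev.2 hab)

/-- **Parity of Hadamard square roots on a `Fintype`-indexed minor** [GRT Ex. 2.3, generalised]: if on a minor
indexed by a finite type `α` the matrix is `c · X`, `c > 0`, `X ∈ {0,1}` invertible over `𝔽₂` (certificate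
`X · Y = 1`), then every real `N` with `N ∘ N = M` has rank `≥ |α|` (transport of the tree's `Fin k` version along
`α ≃ Fin |α|`). [cite: GouveiaRobinsonThomas2013, Ex. 2.3 (p05)] -/
theorem le_rank_of_hadamardSqrt_of_oddMinor' {ι κ α : Type} [Fintype ι] [Fintype κ] [Fintype α]
    [DecidableEq α] {M : ι → κ → ℝ} (ρ : α → ι) (γ : α → κ) (X : α → α → ℕ) (hX : ∀ a b, X a b ≤ 1)
    (c : ℝ) (hc : 0 < c) (hMX : ∀ a b, M (ρ a) (γ b) = c * X a b)
    (Y : Matrix α α (ZMod 2)) (hXY : Matrix.of (fun a b => (X a b : ZMod 2)) * Y = 1)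
    (N : Matrix ι κ ℝ) (hN : ∀ i j, N i j ^ 2 = M i j) : Fintype.card α ≤ N.rank := by
  set e := Fintype.equivFin α
  refine le_rank_of_hadamardSqrt_of_oddMinor (M := M) (ρ ∘ e.symm) (γ ∘ e.symm)
    (fun a b => X (e.symm a) (e.symm b)) (fun a b => hX _ _) c hc (fun a b => hMX _ _)
    (Y.submatrix e.symm e.symm) ?_ N hN
  have h1 : (Matrix.of fun a b : Fin (Fintype.card α) => ((X (e.symm a) (e.symm b) : ℕ) : ZMod 2)) =
      (Matrix.of fun a b => (X a b : ZMod 2)).submatrix e.symm e.symm := rfl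
  rw [h1, Matrix.submatrix_mul_equiv, hXY, Matrix.submatrix_one_equiv]

/-- **The minor-local compression–parity criterion.** Let `M` be a real matrix (arbitrary index types) and
`(ρm, γm)` an `α`-indexed minor on which `M = c · X`, `c > 0`, `X ∈ {0,1}` invertible over `𝔽₂`. If every ROW
OF THE MINOR has a triangular `K`-pattern (anywhere in `M`) inside the columns where it vanishes, and every COLUMN
OF THE MINOR likewise, and `K + 1 < |α|`, then `M` has no psd factorisation of size `K + 1`: compression
[GRT Prop. 2.6] makes the minor's factors rank-one, so the minor has a Hadamard square root of rank `≤ K + 1`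
[FGPRT Prop. 6.2], contradicting the parity count. Compared with the tree's
`not_hasPsdFactorization_of_compression_parity` the patterns are only needed for the minor's rows and columns
and may use rows and columns outside any block. [cite: GouveiaRobinsonThomas2013, Prop. 2.6 + Lemma 2.4 + Ex. 2.3 (p05–p07); FawziEtAl2015, Prop. 6.2 (p18)] -/
theorem not_hasPsdFactorization_of_minor_compression_parity {ι κ α : Type} [Fintype α] [DecidableEq α]
    {M : ι → κ → ℝ} {K : ℕ} (ρm : α → ι) (γm : α → κ)
    (hrow : ∀ a, ∃ (ρ : Fin K → ι) (γ : Fin K → κ),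
      (∀ b, M (ρm a) (γ b) = 0) ∧ (∀ b, M (ρ b) (γ b) ≠ 0) ∧ ∀ b b', b < b' → M (ρ b) (γ b') = 0)
    (hcol : ∀ a, ∃ (ρ : Fin K → ι) (γ : Fin K → κ),
      (∀ b, M (ρ b) (γm a) = 0) ∧ (∀ b, M (ρ b) (γ b) ≠ 0) ∧ ∀ b b', b < b' → M (ρ b) (γ b') = 0)
    (X : α → α → ℕ) (hX : ∀ a b, X a b ≤ 1) (c : ℝ) (hc : 0 < c) (hMX : ∀ a b, M (ρm a) (γm b) = c * X a b)
    (Y : Matrix α α (ZMod 2)) (hXY : Matrix.of (fun a b => (X a b : ZMod 2)) * Y = 1)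
    (hK : K + 1 < Fintype.card α) : ¬ HasPsdFactorization M (K + 1) := by
  rintro ⟨A, B, hA, hB, hM⟩
  have hAr : ∀ a, (A (ρm a)).rank ≤ 1 := fun a => by
    obtain ⟨ρ, γ, h0, hd, ho⟩ := hrow a
    have h := rank_rowFactor_add_le_of_triangular A B hA hB hM (ρm a) ρ γ h0 hd ho
    omega
  have hBr : ∀ a, (B (γm a)).rank ≤ 1 := fun a => by
    obtain ⟨ρ, γ, h0, hd, ho⟩ := hcol a
    have h := rank_colFactor_add_le_of_triangular A B hA hB hM (γm a) ρ γ h0 hd ho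
    omega
  obtain ⟨N, hN, hr⟩ := FawziEtAl2015_prop62_holds α α (Matrix.of fun a b => M (ρm a) (γm b)) (K + 1)
    ⟨fun a => A (ρm a), fun b => B (γm b), fun a => ⟨hA _, hAr a⟩, fun b => ⟨hB _, hBr b⟩,
      fun a b => hM _ _⟩
  have := le_rank_of_hadamardSqrt_of_oddMinor' (M := fun a b => M (ρm a) (γm b)) id id X hX c hc
    (fun a b => hMX a b) Y hXY N hN
  omega

/-- **The `J − I` certificate.** On a finite index type of EVEN cardinality the `0/1` matrix `X = J − I`
(`0` on the diagonal, `1` off it) is its own inverse over `𝔽₂`: `(J + I)² = |α|·J + I = I`. [folklore] -/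
private theorem offDiag_mul_offDiag_eq_one {α : Type} [Fintype α] [DecidableEq α] (heven : Even (Fintype.card α)) :
    (Matrix.of fun a b : α => (((if a = b then 0 else 1 : ℕ) : ℕ) : ZMod 2)) *
      (Matrix.of fun a b : α => (((if a = b then 0 else 1 : ℕ) : ℕ) : ZMod 2)) = 1 := by
  ext a b
  simp only [Matrix.mul_apply, Matrix.of_apply, Nat.cast_ite, Nat.cast_zero, Nat.cast_one, ite_mul, zero_mul,
    one_mul]
  have hsum : (∑ x, if a = x then (0 : ZMod 2) else if x = b then 0 else 1) =
      ∑ x, if x ∈ (Finset.univ.erase a).erase b then (1 : ZMod 2) else 0 := by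
    refine Finset.sum_congr rfl fun x _ => ?_
    by_cases hax : a = x
    · subst hax; simp
    · by_cases hxb : x = b
      · subst hxb; simp [hax]
      · simp [hax, hxb, Ne.symm hax]
  rw [hsum, Finset.sum_boole]
  simp only [Finset.filter_mem_eq_inter, Finset.univ_inter]
  obtain ⟨j, hj⟩ := heven
  have hcard : (Finset.univ : Finset α).card = j + j := by rw [Finset.card_univ, hj]
  by_cases hab : a = b
  · subst hab
    rw [Matrix.one_apply_eq, Finset.erase_idem, Finset.card_erase_of_mem (Finset.mem_univ a), hcard]
    have hj1 : 1 ≤ j := by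
      have : 0 < (Finset.univ : Finset α).card := Finset.card_pos.2 ⟨a, Finset.mem_univ a⟩
      omega
    have : j + j - 1 = 2 * (j - 1) + 1 := by omega
    rw [this, (ZMod.natCast_eq_one_iff_odd).2 ⟨j - 1, rfl⟩]
  · rw [Matrix.one_apply_ne hab, Finset.card_erase_of_mem (by simp [Ne.symm hab]),
      Finset.card_erase_of_mem (Finset.mem_univ a), hcard]
    have hj1 : 1 ≤ j := by
      have : 0 < (Finset.univ : Finset α).card := Finset.card_pos.2 ⟨a, Finset.mem_univ a⟩
      omega
    have : j + j - 1 - 1 = 2 * (j - 1) := by omega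
    rw [this, (ZMod.natCast_eq_zero_iff_even).2 ⟨j - 1, by ring⟩]


/-! ### §1 Odd sets and perfect matchings under relabelling and complement -/

variable {n : ℕ}

/-- Relabelling an odd set by a vertex permutation. [cite: Rothvoss2017, §2 (PDF p. 5)] -/
def imgOdd (σ : Perm (Fin n)) (U : OddSet n) : OddSet n :=
  ⟨U.1.image σ, by rw [card_image_of_injective _ σ.injective]; exact U.2⟩

/-- Relabelling a perfect matching by a vertex permutation. [cite: BraunEtAl2016, §4.5 (p. 9)] -/
def imgPM (σ : Perm (Fin n)) (M : PMatch n) : PMatch n :=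
  ⟨M.1.image (Sym2.map σ), isPMOn_univ_image_map σ M.2⟩

/-- Crossing numbers are invariant under simultaneous relabelling. [cite: Rothvoss2017, §2 (PDF p. 5)] -/
theorem cc_imgOdd_imgPM (σ : Perm (Fin n)) (U : OddSet n) (M : PMatch n) :
    cc (imgOdd σ U) (imgPM σ M) = cc U M := by
  rw [cc_eq_crossCount, cc_eq_crossCount]
  exact crossCount_image σ.injective U.1 M.1

/-- Slack entries are invariant under simultaneous relabelling. [cite: Rothvoss2017, §2 (PDF p. 5)] -/
theorem pmOddCutSlack_img (σ : Perm (Fin n)) (U : OddSet n) (M : PMatch n) :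
    pmOddCutSlack n (imgOdd σ U) (imgPM σ M) = pmOddCutSlack n U M := by
  rw [pmOddCutSlack_apply, pmOddCutSlack_apply, cc_imgOdd_imgPM]

/-- The complement of an odd set of an even ground set is an odd set. [cite: Rothvoss2017, §2 (PDF p. 5)] -/
def complOdd (hn : Even n) (U : OddSet n) : OddSet n :=
  ⟨univ \ U.1, by
    obtain ⟨i, hi⟩ := hn
    obtain ⟨j, hj⟩ := U.2
    have hle : U.1.card ≤ n := by simpa using Finset.card_le_univ U.1
    refine ⟨i - j - 1, ?_⟩
    rw [Finset.card_univ_sdiff, Fintype.card_fin]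
    omega⟩

/-- `|(V \ U)| = n − |U|`. [folklore] -/
private theorem card_complOdd (hn : Even n) (U : OddSet n) : (complOdd hn U).1.card = n - U.1.card := by
  show (univ \ U.1).card = _
  rw [Finset.card_univ_sdiff, Fintype.card_fin]

/-- An edge crosses `U` iff it crosses the complement of `U`. [folklore] -/
private theorem crosses_compl_iff (U : Finset (Fin n)) (e : Sym2 (Fin n)) : Crosses (univ \ U) e ↔ Crosses U e := by
  induction e using Sym2.ind with
  | h x y =>
    rw [crosses_mk, crosses_mk]
    simp only [Finset.mem_sdiff, Finset.mem_univ, true_and]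
    tauto

/-- `|δ(V \ U) ∩ M| = |δ(U) ∩ M|`: a set and its complement have the same cut. [cite: Rothvoss2017, §2 (PDF p. 5)] -/
theorem cc_complOdd (hn : Even n) (U : OddSet n) (M : PMatch n) : cc (complOdd hn U) M = cc U M := by
  unfold cc
  exact congrArg Finset.card (Finset.filter_congr fun e _ => crosses_compl_iff U.1 e)

/-- The rows of `U` and of its complement coincide. [cite: Rothvoss2017, §2 (PDF p. 5)] -/
theorem pmOddCutSlack_complOdd (hn : Even n) (U : OddSet n) (M : PMatch n) :
    pmOddCutSlack n (complOdd hn U) M = pmOddCutSlack n U M := by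
  rw [pmOddCutSlack_apply, pmOddCutSlack_apply, cc_complOdd]

/-- `S_n` is transitive on vertex sets of a given size: odd sets of equal size are relabellings of each other.
[cite: KeevashLifshitz2023, §1.2 (p. 4)] -/
theorem exists_imgOdd_eq (U V : OddSet n) (h : U.1.card = V.1.card) : ∃ σ : Perm (Fin n), imgOdd σ U = V := by
  obtain ⟨σ, -, hσ⟩ := exists_perm_fixing_image_eq (n := n) ((U.1 \ V.1).card) ∅ U.1 V.1 rfl h (by simp)
  exact ⟨σ, Subtype.ext hσ⟩

/-- Conjugating a fixed-point-free involution relabels its edge set. [cite: GodsilMeagher2015, §15.2] -/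
theorem edgesOf_conj (σ s : Perm (Fin n)) : edgesOf (σ * s * σ⁻¹) = (edgesOf s).image (Sym2.map σ) := by
  ext e
  simp only [edgesOf, mem_image, mem_univ, true_and, Perm.mul_apply]
  constructor
  · rintro ⟨x, rfl⟩
    exact ⟨s(σ⁻¹ x, s (σ⁻¹ x)), ⟨σ⁻¹ x, rfl⟩, by simp⟩
  · rintro ⟨_, ⟨y, rfl⟩, rfl⟩
    exact ⟨σ y, by simp⟩

/-- `S_n` is transitive on perfect matchings: every perfect matching is a relabelling of any other.
[cite: GodsilMeagher2015, §15.2 (the perfect matchings form one `S_n`-orbit)] -/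
theorem exists_imgPM_eq (M₀ M : PMatch n) : ∃ σ : Perm (Fin n), imgPM σ M₀ = M := by
  obtain ⟨σ, hσ⟩ := exists_conj_eq (permOf_mem_fpfInvolutions M₀.2) (permOf_mem_fpfInvolutions M.2)
  refine ⟨σ, Subtype.ext ?_⟩
  show M₀.1.image (Sym2.map σ) = M.1
  rw [← edgesOf_permOf M.2, ← hσ, edgesOf_conj, edgesOf_permOf M₀.2]

/-! ### §2 The two ends of the sharp fooling family (`MatchingSlackPsdFoolingSetSharp`) -/

open PsdFoolingSet (rowOf colOf rowNat mkRow two_le_cc_rowOf_colOf cc_rowOf_colOf_eq_one pmOddCutSlack_eq_zero_iff)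

open private idx idxX0 idxC idxY0 idxB idxC1 code card_idx code_injOn shape_of_mem from
  Literature.Barriers.PneNP.MatchingSlackPsdFoolingSetSharp

variable {m : ℕ}

/-- The LAST index of the sharp family (largest code): `C1(3)`, recorded as `(1, n − 1)`; its row is
`{0} ∪ [4, n−1]`, the complement of the `3`-set `{1,2,3}`. [folklore] -/
def lastIdx (m : ℕ) : ℕ × ℕ := (1, 2 * m - 1)

/-- The FIRST index of the sharp family (smallest code): `X0 = (n−1, n−2)`. [folklore] -/
def firstIdx (m : ℕ) : ℕ × ℕ := (2 * m - 1, 2 * m - 2)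

/-- The last index belongs to the family (`m ≥ 3`). [folklore] -/
private theorem lastIdx_mem (hm : 3 ≤ m) : lastIdx m ∈ idx m := by
  simp only [idx, Finset.mem_union, idxC1, Finset.mem_image, Finset.mem_range, lastIdx]
  exact Or.inr ⟨0, by omega, by simp⟩

/-- The first index belongs to the family. [folklore] -/
private theorem firstIdx_mem (m : ℕ) : firstIdx m ∈ idx m := by
  simp [idx, idxX0, firstIdx]

/-- Every other index has a smaller code than the last one. [folklore] -/
private theorem code_lt_code_lastIdx (hm : 3 ≤ m) {y : ℕ × ℕ} (hy : y ∈ idx m) (hne : y ≠ lastIdx m) :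
    code m y < code m (lastIdx m) := by
  have hy3 : 3 ≤ y.1 ∧ y.2 < 2 * m := by
    rcases shape_of_mem hy with h | h | h | h | h
    · omega
    · omega
    · omega
    · omega
    · refine ⟨?_, by omega⟩
      by_contra hlt
      apply hne
      exact Prod.ext (by simp [lastIdx]; omega) (by simp [lastIdx]; omega)
  simp only [code, lastIdx]
  have h1 : (2 * m - y.1 + 2) * (2 * m) ≤ (2 * m - 1) * (2 * m) := Nat.mul_le_mul_right _ (by omega)
  rw [Nat.add_mul] at h1
  generalize (2 * m - y.1) * (2 * m) = A at h1 ⊢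
  generalize (2 * m - 1) * (2 * m) = B at h1 ⊢
  omega

/-- Every other index has a larger code than the first one. [folklore] -/
private theorem code_firstIdx_lt (hm : 3 ≤ m) {x : ℕ × ℕ} (hx : x ∈ idx m) (hne : x ≠ firstIdx m) :
    code m (firstIdx m) < code m x := by
  have hcases : (x.1 ≤ 2 * m - 2 ∧ x.2 < 2 * m) ∨ (x.1 = 2 * m - 1 ∧ x.2 ≤ 2 * m - 3) := by
    rcases shape_of_mem hx with h | h | h | h | h
    · exact absurd (Prod.ext (by simp [firstIdx]; omega) (by simp [firstIdx]; omega)) hne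
    · rcases Nat.lt_or_ge x.1 (2 * m - 1) with h' | h'
      · exact Or.inl ⟨by omega, by omega⟩
      · exact Or.inr ⟨by omega, by omega⟩
    · exact Or.inl ⟨by omega, by omega⟩
    · exact Or.inl ⟨by omega, by omega⟩
    · exact Or.inl ⟨by omega, by omega⟩
  simp only [code, firstIdx]
  rw [show 2 * m - (2 * m - 1) = 1 by omega, one_mul]
  rcases hcases with ⟨h1, h2⟩ | ⟨h1, h2⟩
  · have h3 : 2 * (2 * m) ≤ (2 * m - x.1) * (2 * m) := Nat.mul_le_mul_right _ (by omega)
    generalize (2 * m - x.1) * (2 * m) = A at h3 ⊢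
    omega
  · rw [h1, show 2 * m - (2 * m - 1) = 1 by omega, one_mul]
    omega

/-- The row of the last index is `{0} ∪ [4, n − 1]`, of size `n − 3`. [folklore] -/
private theorem card_rowOf_lastIdx (hm : 3 ≤ m) : (rowOf m hm (lastIdx m)).1.card = 2 * m - 3 := by
  unfold rowOf lastIdx
  rw [if_neg (by dsimp only; omega), dif_neg (by dsimp only; omega), if_neg (by dsimp only; omega),
    dif_neg (by dsimp only; omega), dif_pos (by dsimp only; omega)]
  show ((rowNat 0 ((1 : ℕ) + 3) (2 * m - 1)).attachFin _).card = _
  rw [Finset.card_attachFin, rowNat, Finset.card_insert_of_notMem (by rw [Finset.mem_Icc]; omega), Nat.card_Icc]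
  omega


/-! ### §3 The free patterns: every `3`-row and every column has a triangular `(C(m+1,2) − 2)`-pattern inside its zero set -/

/-- A pattern entry `(U_x, T_y)` of the sharp family with `y` EARLIER than `x` is a zero of the slack matrix.
[cite: FawziEtAl2015, Thm. 2.10 + Ex. 2.11 (p07)] -/
private theorem slack_rowOf_colOf_eq_zero (hm : 3 ≤ m) {x y : ℕ × ℕ} (hx : x ∈ idx m) (hy : y ∈ idx m)
    (h : code m y < code m x) : pmOddCutSlack (2 * m) (rowOf m hm x) (colOf m hm y).toPMatch = 0 :=
  (pmOddCutSlack_eq_zero_iff _ _).2 (cc_rowOf_colOf_eq_one hm hx hy h)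

/-- The diagonal entries `(U_x, T_x)` of the sharp family are non-zeros of the slack matrix.
[cite: FawziEtAl2015, Thm. 2.10 + Ex. 2.11 (p07)] -/
private theorem slack_rowOf_colOf_ne_zero (hm : 3 ≤ m) {x : ℕ × ℕ} (hx : x ∈ idx m) :
    pmOddCutSlack (2 * m) (rowOf m hm x) (colOf m hm x).toPMatch ≠ 0 := fun h => by
  have h1 := (pmOddCutSlack_eq_zero_iff _ _).1 h
  have h2 := two_le_cc_rowOf_colOf hm hx
  omega

/-- Dropping one index of the sharp family leaves `C(m+1,2) − 2` indices. [folklore] -/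
private theorem card_erase_idx (hm : 3 ≤ m) {z : ℕ × ℕ} (hz : z ∈ idx m) :
    ((idx m).erase z).card = (m + 1).choose 2 - 2 := by
  rw [Finset.card_erase_of_mem hz, card_idx hm]
  omega

/-- **Row patterns (free from the sharp family).** For `m ≥ 3`, every `3`-element row `U` of the odd-cut slack
matrix of `K_{2m}` has a triangular pattern of size `C(m+1,2) − 2` inside the columns where it vanishes: the
complement of `U` is a relabelling of the LAST row `{0} ∪ [4, n−1]` of the sharp family, on which every earlier
column is tight, and the earlier indices form a triangular pattern by themselves.
[cite: GouveiaRobinsonThomas2013, Prop. 2.6 (p06); FawziEtAl2015, Thm. 2.10 + Ex. 2.11 (p07)] -/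
theorem exists_rowPattern_three (hm : 3 ≤ m) (U : OddSet (2 * m)) (hU : U.1.card = 3) :
    ∃ (ρ : Fin ((m + 1).choose 2 - 2) → OddSet (2 * m)) (γ : Fin ((m + 1).choose 2 - 2) → PMatch (2 * m)),
      (∀ b, pmOddCutSlack (2 * m) U (γ b) = 0) ∧ (∀ b, pmOddCutSlack (2 * m) (ρ b) (γ b) ≠ 0) ∧
        ∀ b b', b < b' → pmOddCutSlack (2 * m) (ρ b) (γ b') = 0 := by
  have hn : Even (2 * m) := even_two_mul m
  obtain ⟨σ, hσ⟩ := exists_imgOdd_eq (rowOf m hm (lastIdx m)) (complOdd hn U)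
    (by rw [card_rowOf_lastIdx, card_complOdd, hU])
  obtain ⟨f, hfP, hf⟩ := exists_fin_codeDecreasing ((idx m).erase (lastIdx m)) (code m)
    ((code_injOn hm).mono (Finset.coe_subset.2 (Finset.erase_subset _ _)))
  have hK := card_erase_idx hm (lastIdx_mem hm)
  have hfI : ∀ a, f a ∈ idx m := fun a => Finset.mem_of_mem_erase (hfP a)
  have hfne : ∀ a, f a ≠ lastIdx m := fun a => Finset.ne_of_mem_erase (hfP a)
  refine ⟨fun b => imgOdd σ (rowOf m hm (f (Fin.cast hK.symm b))),
    fun b => imgPM σ (colOf m hm (f (Fin.cast hK.symm b))).toPMatch, fun b => ?_, fun b => ?_,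
    fun b b' hbb' => ?_⟩
  · rw [← pmOddCutSlack_complOdd hn U, ← hσ, pmOddCutSlack_img]
    exact slack_rowOf_colOf_eq_zero hm (lastIdx_mem hm) (hfI _) (code_lt_code_lastIdx hm (hfI _) (hfne _))
  · rw [pmOddCutSlack_img]
    exact slack_rowOf_colOf_ne_zero hm (hfI _)
  · rw [pmOddCutSlack_img]
    exact slack_rowOf_colOf_eq_zero hm (hfI _) (hfI _) (hf _ _ hbb')

/-- **Column patterns (free from the sharp family).** For `m ≥ 3`, every column `M` of the odd-cut slack matrix
of `K_{2m}` has a triangular pattern of size `C(m+1,2) − 2` inside the rows where it vanishes: `M` is a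
relabelling of the FIRST column `T(n−1, n−2)` of the sharp family, which is tight on every later row.
[cite: GouveiaRobinsonThomas2013, Prop. 2.6 (p06); FawziEtAl2015, Thm. 2.10 + Ex. 2.11 (p07)] -/
theorem exists_colPattern (hm : 3 ≤ m) (M : PMatch (2 * m)) :
    ∃ (ρ : Fin ((m + 1).choose 2 - 2) → OddSet (2 * m)) (γ : Fin ((m + 1).choose 2 - 2) → PMatch (2 * m)),
      (∀ b, pmOddCutSlack (2 * m) (ρ b) M = 0) ∧ (∀ b, pmOddCutSlack (2 * m) (ρ b) (γ b) ≠ 0) ∧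
        ∀ b b', b < b' → pmOddCutSlack (2 * m) (ρ b) (γ b') = 0 := by
  obtain ⟨σ, hσ⟩ := exists_imgPM_eq (colOf m hm (firstIdx m)).toPMatch M
  obtain ⟨f, hfP, hf⟩ := exists_fin_codeDecreasing ((idx m).erase (firstIdx m)) (code m)
    ((code_injOn hm).mono (Finset.coe_subset.2 (Finset.erase_subset _ _)))
  have hK := card_erase_idx hm (firstIdx_mem m)
  have hfI : ∀ a, f a ∈ idx m := fun a => Finset.mem_of_mem_erase (hfP a)
  have hfne : ∀ a, f a ≠ firstIdx m := fun a => Finset.ne_of_mem_erase (hfP a)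
  refine ⟨fun b => imgOdd σ (rowOf m hm (f (Fin.cast hK.symm b))),
    fun b => imgPM σ (colOf m hm (f (Fin.cast hK.symm b))).toPMatch, fun b => ?_, fun b => ?_,
    fun b b' hbb' => ?_⟩
  · rw [← hσ, pmOddCutSlack_img]
    exact slack_rowOf_colOf_eq_zero hm (hfI _) (firstIdx_mem m) (code_firstIdx_lt hm (hfI _) (hfne _))
  · rw [pmOddCutSlack_img]
    exact slack_rowOf_colOf_ne_zero hm (hfI _)
  · rw [pmOddCutSlack_img]
    exact slack_rowOf_colOf_eq_zero hm (hfI _) (hfI _) (hf _ _ hbb')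

/-! ### §4 An explicit `𝔽₂`-invertible minor of size `(m−1)(m−2)` inside the `3`-set rows -/

/-- **Partner map of the column `N(p,q)`**: the base matching `M₀ = {01, 23, 45, …}` (partner `x ↦ x ± 1`) with
the blocks of `p` (an even label `≥ 2`) and of `q` (a label in a later block) re-matched as `{p, q}, {p+1, q'}`,
`q'` the `M₀`-partner of `q`. [folklore] -/
def swapFun (p q q' x : ℕ) : ℕ :=
  if x = p then q else if x = q then p else if x = p + 1 then q' else if x = q' then p + 1
  else if x % 2 = 0 then x + 1 else x - 1

/-- **The data of a column `N(p,q)`** of the minor, a perfect matching of `K_n` (`n` even) in the vocabulary of the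
Rothvoß files (`PMatch n`, an element of `𝓜_all`): `p` even, `2 ≤ p`, `q ≥ p + 2` (a later block), `q < n`, `q'` the
`M₀`-partner of `q` (encoded linearly as `q' + 2 (q mod 2) = q + 1`). The family itself is the cell's, not Rothvoß's.
[cite: Rothvoss2017, §2 (PDF p. 6: `𝓜_all`, the perfect matchings of `K_n`)] -/
structure SwapCol (n : ℕ) where
  /-- the even label whose block is re-matched [cite: Rothvoss2017, §2 (PDF p. 6)] -/
  p : ℕ
  /-- the label matched to `p` [cite: Rothvoss2017, §2 (PDF p. 6)] -/
  q : ℕ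
  /-- the `M₀`-partner of `q` [cite: Rothvoss2017, §2 (PDF p. 6)] -/
  q' : ℕ
  /-- validity of the data [cite: Rothvoss2017, §2 (PDF p. 6)] -/
  ok : p % 2 = 0 ∧ 2 ≤ p ∧ p + 2 ≤ q ∧ q < n ∧ q' + 2 * (q % 2) = q + 1 ∧ n % 2 = 0

namespace SwapCol

variable (t : SwapCol n)

/-- `N(p,q)` lives on `n` labels. [folklore] -/
private theorem swapFun_lt {x : ℕ} (hx : x < n) : swapFun t.p t.q t.q' x < n := by
  obtain ⟨h1, h2, h3, h4, h5, h6⟩ := t.ok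
  unfold swapFun
  split_ifs <;> omega

/-- `N(p,q)` is an involution. [folklore] -/
private theorem swapFun_swapFun (x : ℕ) : swapFun t.p t.q t.q' (swapFun t.p t.q t.q' x) = x := by
  obtain ⟨h1, h2, h3, h4, h5, h6⟩ := t.ok
  generalize hy : swapFun t.p t.q t.q' x = y
  unfold swapFun at hy ⊢
  split_ifs at hy <;> split_ifs <;> omega

/-- `N(p,q)` has no fixed point. [folklore] -/
private theorem swapFun_ne (x : ℕ) : swapFun t.p t.q t.q' x ≠ x := by
  obtain ⟨h1, h2, h3, h4, h5, h6⟩ := t.ok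
  unfold swapFun
  split_ifs <;> omega

/-- `N(p,q)` as a map of `Fin n`. [folklore] -/
def fin (x : Fin n) : Fin n := ⟨swapFun t.p t.q t.q' x, t.swapFun_lt x.2⟩

/-- `N(p,q)` is an involution of `Fin n`. [folklore] -/
private theorem fin_involutive : Function.Involutive t.fin := fun x => Fin.ext (t.swapFun_swapFun x)

/-- `N(p,q)` as a permutation of `Fin n`. [folklore] -/
def perm : Perm (Fin n) := Function.Involutive.toPerm t.fin t.fin_involutive

/-- `N(p,q)` is a fixed-point-free involution. [folklore] -/
private theorem perm_mem : t.perm ∈ fpfInvolutions n := by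
  rw [mem_fpfInvolutions]
  refine ⟨Equiv.ext fun x => ?_, fun x hx => ?_⟩
  · rw [Perm.mul_apply, Perm.one_apply]
    exact t.fin_involutive x
  · exact t.swapFun_ne x (congrArg Fin.val hx)

/-- **The perfect matching `N(p,q)` of `K_n`** (a column of the odd-cut slack matrix).
[cite: Rothvoss2017, §2 (PDF p. 6: `𝓜_all`, the perfect matchings of `K_n`)] -/
def toPMatch : PMatch n := ⟨edgesOf t.perm, isPMOn_edgesOf t.perm_mem⟩

/-- Edges of `N(p,q)` are read off the partner map. [folklore] -/
private theorem mk_mem_toPMatch_iff (x y : Fin n) : s(x, y) ∈ t.toPMatch.1 ↔ (y : ℕ) = swapFun t.p t.q t.q' x := by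
  show s(x, y) ∈ edgesOf t.perm ↔ _
  rw [mk_mem_edgesOf_iff t.perm_mem, Fin.ext_iff]
  rfl

/-- `N(p,q)` matches the label `1` to `0` (the block `{0,1}` is untouched). [folklore] -/
private theorem swapFun_one : swapFun t.p t.q t.q' 1 = 0 := by
  obtain ⟨h1, h2, h3, h4, h5, h6⟩ := t.ok
  unfold swapFun
  split_ifs <;> omega

/-- **The identity pattern.** For two columns `N(p,q)`, `N(p₁,q₁)` of the minor, `N(p₁,q₁)` matches `p` to `q`
iff `(p₁,q₁) = (p,q)`: the edge `{p,q}` of the row `{1,p,q}` lies in its own column only. [folklore] -/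
private theorem swapFun_eq_iff (t₁ : SwapCol n) : swapFun t₁.p t₁.q t₁.q' t.p = t.q ↔ t.p = t₁.p ∧ t.q = t₁.q := by
  obtain ⟨h1, h2, h3, h4, h5, h6⟩ := t.ok
  obtain ⟨g1, g2, g3, g4, g5, g6⟩ := t₁.ok
  unfold swapFun
  split_ifs <;> omega

end SwapCol

/-- **The index set of the minor**: pairs `(p, q)` with `p` even, `2 ≤ p`, `p + 2 ≤ q < 2m`
(parametrised by `j < m − 2`, `r < 2j + 2` as `p = 2m − 4 − 2j`, `q = p + 2 + r`). [folklore] -/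
def minorIdx (m : ℕ) : Finset (ℕ × ℕ) :=
  ((Finset.range (m - 2)).sigma fun j => Finset.range (2 * j + 2)).image
    fun x => (2 * m - 4 - 2 * x.1, 2 * m - 2 - 2 * x.1 + x.2)

/-- Shape of an index of the minor. [folklore] -/
private theorem shape_of_mem_minorIdx {x : ℕ × ℕ} (hx : x ∈ minorIdx m) :
    x.1 % 2 = 0 ∧ 2 ≤ x.1 ∧ x.1 + 2 ≤ x.2 ∧ x.2 < 2 * m := by
  simp only [minorIdx, Finset.mem_image, Finset.mem_sigma, Finset.mem_range] at hx
  obtain ⟨⟨j, r⟩, ⟨hj, hr⟩, rfl⟩ := hx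
  dsimp only at hj hr ⊢
  omega

/-- `Σ_{j<k} (2j + 2) = k(k+1)`. [folklore] -/
private theorem sum_range_two_mul_add_two (k : ℕ) : ∑ j ∈ Finset.range k, (2 * j + 2) = k * (k + 1) := by
  induction k with
  | zero => simp
  | succ k ih => rw [Finset.sum_range_succ, ih]; ring

/-- **The minor has `(m−1)(m−2)` indices.** [folklore] -/
private theorem card_minorIdx (hm : 3 ≤ m) : (minorIdx m).card = (m - 1) * (m - 2) := by
  rw [minorIdx, Finset.card_image_of_injOn, Finset.card_sigma]
  · simp only [Finset.card_range]
    rw [sum_range_two_mul_add_two, show m - 2 + 1 = m - 1 by omega, Nat.mul_comm]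
  · rintro ⟨j, r⟩ hx ⟨j', r'⟩ hy h
    simp only [Finset.coe_sigma, Set.mem_sigma_iff, Finset.coe_range, Set.mem_Iio] at hx hy
    simp only [Prod.mk.injEq] at h
    obtain ⟨ha, hb⟩ := h
    have hj : j = j' := by omega
    subst hj
    have hr : r = r' := by omega
    subst hr
    rfl

/-- `(m−1)(m−2)` is even. [folklore] -/
private theorem even_card_minorIdx (hm : 3 ≤ m) : Even (Fintype.card (minorIdx m)) := by
  rw [Fintype.card_coe, card_minorIdx hm, show m - 2 = (m - 1) - 1 by omega]
  exact Nat.even_mul_pred_self (m - 1)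

/-- For `m ≥ 7` the minor is larger than the sharp fooling bound: `C(m+1,2) ≤ (m−1)(m−2)`. [folklore] -/
private theorem choose_le_card_minorIdx (hm : 7 ≤ m) : (m + 1).choose 2 ≤ (m - 1) * (m - 2) := by
  obtain ⟨k, rfl⟩ := Nat.exists_eq_add_of_le hm
  rw [Nat.choose_two_right, show 7 + k + 1 = k + 8 by omega, show 7 + k - 1 = k + 6 by omega,
    show 7 + k - 2 = k + 5 by omega, show k + 8 - 1 = k + 7 by omega]
  apply Nat.div_le_of_le_mul
  nlinarith

/-- **The rows of the minor**: the triangles `{1, p, q}`. [cite: Rothvoss2017, §2 (PDF p. 5)] -/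
def minorTri (a : minorIdx m) : Tri (2 * m) :=
  ⟨(⟨1, by have := shape_of_mem_minorIdx a.2; omega⟩, ⟨a.1.1, by have := shape_of_mem_minorIdx a.2; omega⟩,
    ⟨a.1.2, by have := shape_of_mem_minorIdx a.2; omega⟩), by
    obtain ⟨h1, h2, h3, h4⟩ := shape_of_mem_minorIdx a.2
    refine ⟨?_, ?_, ?_⟩ <;> simp only [ne_eq, Fin.ext_iff] <;> omega⟩

/-- **The columns of the minor**: the matchings `N(p,q)`. [cite: Rothvoss2017, §2 (PDF p. 6)] -/
def minorCol (a : minorIdx m) : SwapCol (2 * m) :=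
  ⟨a.1.1, a.1.2, a.1.2 + 1 - 2 * (a.1.2 % 2), by obtain ⟨h1, h2, h3, h4⟩ := shape_of_mem_minorIdx a.2; omega⟩

/-- A triangle row has three elements. [folklore] -/
private theorem card_toOdd (t : Tri n) : t.toOdd.1.card = 3 :=
  Finset.card_eq_three.2 ⟨t.a, t.b, t.c, t.2.1, t.2.2.1, t.2.2.2, rfl⟩

/-- **The minor is `2·(J − I)`**: `S({1,p,q}, N(p₁,q₁)) = 2 − 2·[(p,q) = (p₁,q₁)]`, since `N(p₁,q₁)` matches `1`
to `0` and contains the edge `{p,q}` iff `(p₁,q₁) = (p,q)` (a perfect matching meets a triangle in at most one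
edge, `OddCutRank.pmOddCutSlack_toOdd`). [cite: Rothvoss2017, §2 (PDF p. 5)] -/
theorem slack_minor (a b : minorIdx m) :
    pmOddCutSlack (2 * m) (minorTri a).toOdd (minorCol b).toPMatch =
      2 * ((if a = b then 0 else 1 : ℕ) : ℝ) := by
  obtain ⟨ha1, ha2, ha3, ha4⟩ := shape_of_mem_minorIdx a.2
  rw [pmOddCutSlack_toOdd, pmVec_apply, pmVec_apply, pmVec_apply]
  have e1 : (minorTri a).eab.1 ∉ (minorCol b).toPMatch.1 := by
    show s(_, _) ∉ _
    rw [SwapCol.mk_mem_toPMatch_iff]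
    show ¬ (a.1.1 = swapFun (minorCol b).p (minorCol b).q (minorCol b).q' 1)
    rw [SwapCol.swapFun_one]
    omega
  have e2 : (minorTri a).eac.1 ∉ (minorCol b).toPMatch.1 := by
    show s(_, _) ∉ _
    rw [SwapCol.mk_mem_toPMatch_iff]
    show ¬ (a.1.2 = swapFun (minorCol b).p (minorCol b).q (minorCol b).q' 1)
    rw [SwapCol.swapFun_one]
    omega
  have e3 : (minorTri a).ebc.1 ∈ (minorCol b).toPMatch.1 ↔ a = b := by
    show s(_, _) ∈ _ ↔ _
    rw [SwapCol.mk_mem_toPMatch_iff]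
    show (minorCol a).q = swapFun (minorCol b).p (minorCol b).q (minorCol b).q' (minorCol a).p ↔ _
    rw [eq_comm, SwapCol.swapFun_eq_iff (minorCol a) (minorCol b), Subtype.ext_iff, Prod.ext_iff]
    exact Iff.rfl
  rw [if_neg e1, if_neg e2]
  by_cases hab : a = b
  · rw [if_pos (e3.2 hab), if_pos hab]
    norm_num
  · rw [if_neg (fun h => hab (e3.1 h)), if_neg hab]
    norm_num

/-! ### §5 Assembly: `rk_psd(S_odd(K_{2m})) ≥ C(m+1, 2)` for `m ≥ 7`, and for every even `n ≥ 8` -/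

/-- `C(m+1, 2) ≥ 2` for `m ≥ 3`. [folklore] -/
private theorem two_le_choose (hm : 3 ≤ m) : 2 ≤ (m + 1).choose 2 := by
  calc 2 ≤ (3 + 1).choose 2 := by decide
    _ ≤ (m + 1).choose 2 := Nat.choose_le_choose 2 (by omega)

/-- **No psd factorisation of the sharp fooling size.** For `m ≥ 7` the odd-cut slack matrix of the perfect
matching polytope of `K_{2m}` has NO psd factorisation of size `C(m+1,2) − 1` (the size of the sharp triangular
pattern of `MatchingSlackPsdFoolingSetSharp`, the exact optimum of the support-based method for `m ≤ 6`):
minor-local compression on the `3`-rows `{1,p,q}` and the columns `N(p,q)` (free patterns of §3) plus the parity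
count on the `(m−1)(m−2) × (m−1)(m−2)` minor `2(J − I)` of §4.
[cite: GouveiaRobinsonThomas2013, Prop. 2.6 + Lemma 2.4 + Ex. 2.3 (p05–p07); FawziEtAl2015, Prop. 6.2 (p18)] -/
theorem not_hasPsdFactorization_pmOddCutSlack_choose (hm : 7 ≤ m) :
    ¬ HasPsdFactorization (pmOddCutSlack (2 * m)) ((m + 1).choose 2 - 1) := by
  have hm3 : 3 ≤ m := by omega
  have h2 := two_le_choose hm3
  rw [show (m + 1).choose 2 - 1 = ((m + 1).choose 2 - 2) + 1 by omega]
  refine not_hasPsdFactorization_of_minor_compression_parity (α := minorIdx m)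
    (fun a => (minorTri a).toOdd) (fun b => (minorCol b).toPMatch)
    (fun a => exists_rowPattern_three hm3 _ (card_toOdd _)) (fun b => exists_colPattern hm3 _)
    (fun a b => if a = b then 0 else 1) (fun a b => by split_ifs <;> simp) 2 two_pos
    (fun a b => slack_minor a b) _ (offDiag_mul_offDiag_eq_one (even_card_minorIdx hm3)) ?_
  rw [Fintype.card_coe, card_minorIdx hm3]
  have := choose_le_card_minorIdx hm
  omega

/-- **`rk_psd(S_odd(K_{2m})) ≥ C(m+1, 2)` for `m ≥ 7`.** [cite: GouveiaRobinsonThomas2013, Prop. 2.6 + Lemma 2.4 + Ex. 2.3 (p05–p07); FawziEtAl2015, Prop. 6.2 (p18)] -/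
theorem choose_le_of_hasPsdFactorization (hm : 7 ≤ m) {r : ℕ}
    (h : HasPsdFactorization (pmOddCutSlack (2 * m)) r) : (m + 1).choose 2 ≤ r := by
  by_contra hlt
  exact not_hasPsdFactorization_pmOddCutSlack_choose hm (h.mono (by omega))

/-- **Main theorem: `rk_psd(S_odd(K_n)) ≥ C(n/2 + 1, 2)` for every even `n ≥ 8`** — one more than the sharp
fooling-set bound `C(n/2+1,2) − 1` of `MatchingSlackPsdFoolingSetSharp` (the exact maximum triangular pattern for
`n ≤ 12`), now for all `n` at once: `m = n/2 ≥ 7` by the parametric argument of this file, `n = 8, 10, 12` by the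
kernel-checked instances `MatchingSlackPsdRank{Eight,Ten,Twelve}Lower`. Values: `10, 15, 21, 28, 36, 45, …`.
[cite: GouveiaRobinsonThomas2013, Prop. 2.6 + Lemma 2.4 + Ex. 2.3 (p05–p07); FawziEtAl2015, Prop. 6.2 (p18)] -/
theorem choose_half_succ_le_of_hasPsdFactorization {n r : ℕ} (hn : Even n) (h8 : 8 ≤ n)
    (h : HasPsdFactorization (pmOddCutSlack n) r) : (n / 2 + 1).choose 2 ≤ r := by
  obtain ⟨m, rfl⟩ := hn
  rw [← two_mul] at h h8 ⊢
  rw [show 2 * m / 2 = m by omega]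
  by_cases h7 : 7 ≤ m
  · exact choose_le_of_hasPsdFactorization h7 h
  · obtain rfl | rfl | rfl : m = 4 ∨ m = 5 ∨ m = 6 := by omega
    · exact ten_le_of_hasPsdFactorization_eight h
    · exact fifteen_le_of_hasPsdFactorization_ten h
    · exact succ_le_of_hasPsdFactorization_twelve h

/-- The same statement as a non-existence: for even `n ≥ 8` the odd-cut slack matrix of `K_n` has no psd
factorisation of size `C(n/2+1, 2) − 1`. [cite: GouveiaRobinsonThomas2013, Prop. 2.6 + Lemma 2.4 + Ex. 2.3 (p05–p07)] -/
theorem not_hasPsdFactorization_pmOddCutSlack_even {n : ℕ} (hn : Even n) (h8 : 8 ≤ n) :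
    ¬ HasPsdFactorization (pmOddCutSlack n) ((n / 2 + 1).choose 2 - 1) := fun h => by
  have h1 := choose_half_succ_le_of_hasPsdFactorization hn h8 h
  have h2 : 2 ≤ (n / 2 + 1).choose 2 := two_le_choose (by omega)
  omega

/-- **Sharpness of `n ≥ 8`.** At `n = 6` the bound `C(n/2+1, 2)` FAILS: the odd-cut slack matrix of `K_6` has a psd
factorisation of size `5 = C(4,2) − 1` (`PsdRankSmall.hasPsdFactorization_pmOddCutSlack_six`, the exact value), so the
main theorem's hypothesis `8 ≤ n` cannot be weakened. [cite: FawziEtAl2015, Thm. 2.10 + Ex. 2.11 (p07)] -/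
theorem hasPsdFactorization_pmOddCutSlack_six_choose :
    HasPsdFactorization (pmOddCutSlack 6) ((6 / 2 + 1).choose 2 - 1) := by
  have h : ((6 : ℕ) / 2 + 1).choose 2 - 1 = 5 := by decide
  rw [h]
  exact PsdRankSmall.hasPsdFactorization_pmOddCutSlack_six

/-- The threshold form: for even `n ≥ 6`, «every psd factorisation of `S_odd(K_n)` has size `≥ C(n/2+1, 2)`» holds iff
`n ≥ 8`. [cite: FawziEtAl2015, Thm. 2.10 + Ex. 2.11 (p07); GouveiaRobinsonThomas2013, Prop. 2.6 + Ex. 2.3 (p05–p06)] -/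
theorem choose_half_succ_le_iff {n : ℕ} (hn : Even n) (h6 : 6 ≤ n) :
    (∀ r, HasPsdFactorization (pmOddCutSlack n) r → (n / 2 + 1).choose 2 ≤ r) ↔ 8 ≤ n := by
  constructor
  · intro h
    by_contra h8
    obtain rfl : n = 6 := by obtain ⟨m, rfl⟩ := hn; omega
    have := h _ hasPsdFactorization_pmOddCutSlack_six_choose
    revert this
    decide
  · exact fun h8 r hr => choose_half_succ_le_of_hasPsdFactorization hn h8 hr

end PsdRankBeyondFooling

end Literature.Barriers.PneNP
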